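import Literature.NumberTheory.Sieve.FordMaynardPrimeSumsOneDim
import Literature.NumberTheory.LFunctions.MertensFormula
import Mathlib.MeasureTheory.Constructions.Pi
import Mathlib.MeasureTheory.Integral.Prod
import Mathlib.MeasureTheory.Measure.Lebesgue.Basic
import Mathlib.Analysis.Convex.Basic
import Mathlib.Data.Fin.Tuple.Finset
import HarnessLib

/-!
# Prime sums against Lipschitz test functions in logarithmic scale (several prime variables)

Second file of the arithmetic half of Theorem 6.3 (a) / Theorem 9.1 of K. Ford, J. Maynard,
*On the theory of prime producing sieves* (arXiv:2407.14368). Everything here is PROVED. We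
extend the one-variable comparison of `FordMaynardPrimeSumsOneDim.lean` to sums over `s`-tuples
of primes:

  `∑_{q₁,…,q_s ≤ x prime} G(log q₁/log x, …, log q_s/log x)
     = ∫_{ℝ^s} G(y) ∏ᵢ x^{yᵢ} dyᵢ/yᵢ + O_{s,η',A}((K + M) x^Y (log x)^{-A})`

uniformly over test functions `G` that are `K`-Lipschitz (sup norm) on a CONVEX measurable set
`U ⊆ {yᵢ ≥ η', ∑ yᵢ ≤ Y}` (`Y ≤ 1`), bounded by `M` and zero outside `U`
(`exists_primeTupleSum_approx`). This replaces Ford–Maynard's Lemma 5.11 (boxes, Lemma 5.9 on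
covering boundaries of convex sets, and Huxley's prime number theorem in short intervals) by an
induction on `s`: peel off the last prime with the one-variable estimate at fixed values of the
other primes (a section of a convex set along a coordinate line is an interval, on which `G` is
Lipschitz), then apply the induction hypothesis to the sections `G(·, t)` inside the
`t`-integral; the two error terms are summed with Mertens' bound `∑_{x^{η'} ≤ p ≤ x} 1/p ≪_{η'} 1`
(tree: `MertensFormula.lean`) and `∫_{η'}^1 dt/t = log(1/η')`.

* `FordMaynard.primeTupleSum s x G`, `FordMaynard.primeTupleIntegral s x G` — the two sides;
* `FordMaynard.primeTupleSum_succ`, `FordMaynard.primeTupleIntegral_succ` — peeling the last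
  variable (sum side: `Fin.snoc`; integral side: Fubini);
* `FordMaynard.exists_sum_primesLE_inv_window_le` — `∑_{x^{η'} ≤ p ≤ x} 1/p ≤ C(η')`;
* `FordMaynard.exists_primeTupleSum_approx` — the main estimate.

## References

* K. Ford, J. Maynard, *On the theory of prime producing sieves*, arXiv:2407.14368v1 (2024), §5.5
  Lemma 5.11 and §6.2 (proof of Theorem 6.3 (a)). [FordMaynard2024PrimeSieves]
-/

noncomputable section

open MeasureTheory Finset Real
open scoped Chebyshev

namespace Literature.NumberTheory.Sieve.FordMaynard

/-! ### The two sides -/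

/-- The vector of logarithmic coordinates `(log qᵢ / log x)ᵢ` of a tuple of naturals. [folklore] -/
def logVec {s : ℕ} (x : ℝ) (q : Fin s → ℕ) : Fin s → ℝ := fun i => Real.log (q i) / Real.log x

/-- The prime tuple sum `∑_{q₁,…,q_s ≤ x prime} G(log q₁/log x, …, log q_s/log x)`.
[cite: FordMaynard2024PrimeSieves, Lemma 5.11] -/
def primeTupleSum (s : ℕ) (x : ℝ) (G : (Fin s → ℝ) → ℝ) : ℝ :=
  ∑ q ∈ Fintype.piFinset (fun _ : Fin s => Nat.primesLE ⌊x⌋₊), G (logVec x q)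

/-- The weight `∏ᵢ x^{yᵢ}/yᵢ` of the comparison integral. [cite: FordMaynard2024PrimeSieves, Lemma 5.11] -/
def tupleWeight {s : ℕ} (x : ℝ) (y : Fin s → ℝ) : ℝ := ∏ i, (x ^ (y i) / y i)

/-- The comparison integral `∫_{ℝ^s} G(y) ∏ᵢ x^{yᵢ} dyᵢ/yᵢ`. [cite: FordMaynard2024PrimeSieves, Lemma 5.11] -/
def primeTupleIntegral (s : ℕ) (x : ℝ) (G : (Fin s → ℝ) → ℝ) : ℝ :=
  ∫ y : Fin s → ℝ, G y * tupleWeight x y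

/-! ### `Fin.snoc` bookkeeping -/

/-- `logVec` of an extended tuple. [folklore] -/
theorem logVec_snoc {s : ℕ} (x : ℝ) (q : Fin s → ℕ) (p : ℕ) :
    logVec x (Fin.snoc q p) = Fin.snoc (logVec x q) (Real.log p / Real.log x) := by
  funext i
  refine Fin.lastCases ?_ (fun j => ?_) i
  · simp [logVec]
  · simp [logVec]

/-- `y' ↦ snoc y' t` is measurable. [folklore] -/
theorem measurable_snoc_left {s : ℕ} (t : ℝ) :
    Measurable fun y' : Fin s → ℝ => (Fin.snoc y' t : Fin (s + 1) → ℝ) := by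
  refine measurable_pi_lambda _ fun i => ?_
  refine Fin.lastCases ?_ (fun j => ?_) i
  · simp only [Fin.snoc_last]; exact measurable_const
  · simp only [Fin.snoc_castSucc]; exact measurable_pi_apply j

/-- `t ↦ snoc y' t` is measurable. [folklore] -/
theorem measurable_snoc_right {s : ℕ} (y' : Fin s → ℝ) :
    Measurable fun t : ℝ => (Fin.snoc y' t : Fin (s + 1) → ℝ) := by
  refine measurable_pi_lambda _ fun i => ?_
  refine Fin.lastCases ?_ (fun j => ?_) i
  · simp only [Fin.snoc_last]; exact measurable_id
  · simp only [Fin.snoc_castSucc]; exact measurable_const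

/-- `(y', t) ↦ snoc y' t` is jointly measurable. [folklore] -/
theorem measurable_snoc_prod {s : ℕ} :
    Measurable fun p : ℝ × (Fin s → ℝ) => (Fin.snoc p.2 p.1 : Fin (s + 1) → ℝ) := by
  refine measurable_pi_lambda _ fun i => ?_
  refine Fin.lastCases ?_ (fun j => ?_) i
  · simp only [Fin.snoc_last]; exact measurable_fst
  · simp only [Fin.snoc_castSucc]; exact (measurable_pi_apply j).comp measurable_snd

/-- Convex combinations commute with `snoc` at a fixed last coordinate. [folklore] -/
theorem snoc_convex_comb {s : ℕ} (y z : Fin s → ℝ) (t a b : ℝ) (hab : a + b = 1) :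
    (Fin.snoc (a • y + b • z) t : Fin (s + 1) → ℝ) = a • Fin.snoc y t + b • Fin.snoc z t := by
  funext i
  refine Fin.lastCases ?_ (fun j => ?_) i
  · simp only [Fin.snoc_last, Pi.add_apply, Pi.smul_apply, smul_eq_mul]
    rw [← add_mul, hab, one_mul]
  · simp [Fin.snoc_castSucc]

/-- Convex combinations commute with `snoc` at a fixed initial segment. [folklore] -/
theorem snoc_convex_comb_right {s : ℕ} (y : Fin s → ℝ) (t t' a b : ℝ) (hab : a + b = 1) :
    (Fin.snoc y (a * t + b * t') : Fin (s + 1) → ℝ) = a • Fin.snoc y t + b • Fin.snoc y t' := by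
  funext i
  refine Fin.lastCases ?_ (fun j => ?_) i
  · simp [Fin.snoc_last]
  · simp only [Fin.snoc_castSucc, Pi.add_apply, Pi.smul_apply, smul_eq_mul]
    rw [← add_mul, hab, one_mul]

/-- Sections of a convex set at a fixed last coordinate are convex. [folklore] -/
theorem convex_section_left {s : ℕ} {U : Set (Fin (s + 1) → ℝ)} (hU : Convex ℝ U) (t : ℝ) :
    Convex ℝ {y' : Fin s → ℝ | Fin.snoc y' t ∈ U} := by
  intro y hy z hz a b ha hb hab
  show Fin.snoc (a • y + b • z) t ∈ U
  rw [snoc_convex_comb y z t a b hab]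
  exact hU hy hz ha hb hab

/-- Sections of a convex set along the last coordinate line are intervals. [folklore] -/
theorem ordConnected_section_right {s : ℕ} {U : Set (Fin (s + 1) → ℝ)} (hU : Convex ℝ U)
    (y : Fin s → ℝ) : Set.OrdConnected {t : ℝ | Fin.snoc y t ∈ U} := by
  have hc : Convex ℝ {t : ℝ | Fin.snoc y t ∈ U} := by
    intro t ht t' ht' a b ha hb hab
    show Fin.snoc y (a • t + b • t') ∈ U
    rw [smul_eq_mul, smul_eq_mul, snoc_convex_comb_right y t t' a b hab]
    exact hU ht ht' ha hb hab
  exact hc.ordConnected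

/-- The sup distance of two `snoc`s with the same last coordinate. [folklore] -/
theorem norm_snoc_sub_snoc_left {s : ℕ} (y z : Fin s → ℝ) (t : ℝ) :
    ‖(Fin.snoc y t : Fin (s + 1) → ℝ) - Fin.snoc z t‖ = ‖y - z‖ := by
  apply le_antisymm
  · refine (pi_norm_le_iff_of_nonneg (norm_nonneg _)).2 fun i => ?_
    refine Fin.lastCases ?_ (fun j => ?_) i
    · simp
    · simp only [Pi.sub_apply, Fin.snoc_castSucc]
      exact norm_le_pi_norm (y - z) j
  · refine (pi_norm_le_iff_of_nonneg (norm_nonneg _)).2 fun j => ?_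
    have := norm_le_pi_norm ((Fin.snoc y t : Fin (s + 1) → ℝ) - Fin.snoc z t) (Fin.castSucc j)
    simpa only [Pi.sub_apply, Fin.snoc_castSucc] using this

/-- The sup distance of two `snoc`s with the same initial segment. [folklore] -/
theorem norm_snoc_sub_snoc_right {s : ℕ} (y : Fin s → ℝ) (t t' : ℝ) :
    ‖(Fin.snoc y t : Fin (s + 1) → ℝ) - Fin.snoc y t'‖ = |t - t'| := by
  apply le_antisymm
  · refine (pi_norm_le_iff_of_nonneg (abs_nonneg _)).2 fun i => ?_
    refine Fin.lastCases ?_ (fun j => ?_) i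
    · simp [Real.norm_eq_abs]
    · simp
  · have := norm_le_pi_norm ((Fin.snoc y t : Fin (s + 1) → ℝ) - Fin.snoc y t') (Fin.last s)
    simpa only [Pi.sub_apply, Fin.snoc_last, Real.norm_eq_abs] using this

/-! ### Peeling off the last prime variable: the sum side -/

/-- **Sum side.** `∑_{q ∈ P^{s+1}} F(q) = ∑_{q' ∈ P^s} ∑_{p ∈ P} F(snoc q' p)`. [folklore] -/
theorem sum_piFinset_succ {s : ℕ} (P : Finset ℕ) (F : (Fin (s + 1) → ℕ) → ℝ) :
    ∑ q ∈ Fintype.piFinset (fun _ : Fin (s + 1) => P), F q =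
      ∑ q' ∈ Fintype.piFinset (fun _ : Fin s => P), ∑ p ∈ P, F (Fin.snoc q' p) := by
  classical
  have h := Finset.filter_piFinset_eq_map_snocEquiv (fun _ : Fin (s + 1) => P) (fun _ => True)
  simp only [Finset.filter_true] at h
  rw [h, Finset.sum_map, Finset.sum_product, Finset.sum_comm]
  rfl

/-- **Sum side for `primeTupleSum`.** [folklore] -/
theorem primeTupleSum_succ (s : ℕ) (x : ℝ) (G : (Fin (s + 1) → ℝ) → ℝ) :
    primeTupleSum (s + 1) x G =
      ∑ q' ∈ Fintype.piFinset (fun _ : Fin s => Nat.primesLE ⌊x⌋₊),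
        ∑ p ∈ Nat.primesLE ⌊x⌋₊, G (Fin.snoc (logVec x q') (Real.log p / Real.log x)) := by
  unfold primeTupleSum
  rw [sum_piFinset_succ]
  refine Finset.sum_congr rfl fun q' _ => Finset.sum_congr rfl fun p _ => ?_
  rw [logVec_snoc]

/-- The inner sums are prime tuple sums of sections. [folklore] -/
theorem primeTupleSum_section (s : ℕ) (x : ℝ) (G : (Fin (s + 1) → ℝ) → ℝ) (t : ℝ) :
    primeTupleSum s x (fun y' => G (Fin.snoc y' t)) =
      ∑ q' ∈ Fintype.piFinset (fun _ : Fin s => Nat.primesLE ⌊x⌋₊), G (Fin.snoc (logVec x q') t) :=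
  rfl

/-! ### Peeling off the last variable: the integral side -/

/-- The weight of an extended vector. [folklore] -/
theorem tupleWeight_snoc {s : ℕ} (x : ℝ) (y' : Fin s → ℝ) (t : ℝ) :
    tupleWeight x (Fin.snoc y' t : Fin (s + 1) → ℝ) = tupleWeight x y' * (x ^ t / t) := by
  unfold tupleWeight
  rw [Fin.prod_univ_castSucc]
  simp only [Fin.snoc_castSucc, Fin.snoc_last]

/-- The symm of `piFinSuccAbove` at the last index is `Fin.snoc`. [folklore] -/
theorem piFinSuccAbove_last_symm_apply (s : ℕ) (p : ℝ × (Fin s → ℝ)) :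
    (MeasurableEquiv.piFinSuccAbove (fun _ => ℝ) (Fin.last s)).symm p = Fin.snoc p.2 p.1 := by
  obtain ⟨t, v⟩ := p
  simp [MeasurableEquiv.piFinSuccAbove, Fin.insertNthEquiv, Fin.insertNth_last']

/-- **Integral side (Fubini).** For `H` integrable on `ℝ^{s+1}`,
`∫ H = ∫_t ∫_{y'} H(snoc y' t) dy' dt`, and the inner integrals are an integrable function of `t`.
[folklore] -/
theorem integral_eq_integral_snoc {s : ℕ} {H : (Fin (s + 1) → ℝ) → ℝ} (hH : Integrable H) :
    (∫ y, H y) = ∫ t : ℝ, ∫ y' : Fin s → ℝ, H (Fin.snoc y' t) ∧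
      Integrable (fun t : ℝ => ∫ y' : Fin s → ℝ, H (Fin.snoc y' t)) := by
  set e := MeasurableEquiv.piFinSuccAbove (fun _ : Fin (s + 1) => ℝ) (Fin.last s) with he
  have hmp : MeasurePreserving e := volume_preserving_piFinSuccAbove (fun _ : Fin (s + 1) => ℝ) _
  have h1 : ∫ y, H y = ∫ p : ℝ × (Fin s → ℝ), H (Fin.snoc p.2 p.1) := by
    rw [← hmp.symm.integral_comp' (f := e.symm)]
    refine integral_congr_ae (Filter.Eventually.of_forall fun p => ?_)
    show H (e.symm p) = H (Fin.snoc p.2 p.1)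
    rw [he, piFinSuccAbove_last_symm_apply]
  have hint2 : Integrable (fun p : ℝ × (Fin s → ℝ) => H (Fin.snoc p.2 p.1)) (volume.prod volume) := by
    have := hmp.symm.integrable_comp_emb e.symm.measurableEmbedding |>.2 hH
    refine (integrable_congr (Filter.Eventually.of_forall fun p => ?_)).1 this
    show H (e.symm p) = _
    rw [he, piFinSuccAbove_last_symm_apply]
  refine ⟨?_, hint2.integral_prod_left⟩
  rw [h1, show (volume : Measure (ℝ × (Fin s → ℝ))) = volume.prod volume from rfl,
    integral_prod _ hint2]

/-! ### Mertens: the window sum `∑_{x^{η'} ≤ p ≤ x} 1/p` -/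

/-- **Window form of Mertens' second theorem**: for `0 < η'` there are `W` and `X` with
`∑_{p ≤ x prime, log p/log x ≥ η'} 1/p ≤ W` for all `x ≥ X` (from the tree's PROVED two-sided
Mertens estimate `|∑_{p ≤ x} 1/p − log log x − B₁| ≤ 8/log x`). [cite: MontgomeryVaughan2007, Theorem 2.7 (d)] -/
theorem exists_sum_primesLE_inv_window_le (η' : ℝ) (hη' : 0 < η') (hη'1 : η' ≤ 1) :
    ∃ W : ℝ, 0 ≤ W ∧ ∃ X : ℝ, 2 ≤ X ∧ ∀ x : ℝ, X ≤ x →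
      ∑ p ∈ (Nat.primesLE ⌊x⌋₊).filter (fun p : ℕ => η' ≤ Real.log p / Real.log x), (p : ℝ)⁻¹ ≤
        W := by
  obtain ⟨X, hX2, hX⟩ := eventually_largeX (η' / 2) (by positivity) 0
  have hlog2 : 0 < Real.log 2 := Real.log_pos one_lt_two
  have hlogη : 0 ≤ Real.log (2 / η') :=
    Real.log_nonneg ((one_le_div hη').2 (by linarith))
  refine ⟨Real.log (2 / η') + 16 / Real.log 2, by positivity, X, hX2, fun x hx => ?_⟩
  obtain ⟨hx3, hz2, -⟩ := hX x hx
  have hx1 : 1 < x := by linarith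
  have hx0 : 0 < x := by linarith
  have hx2 : 2 ≤ x := by linarith
  have hL0 : 0 < Real.log x := Real.log_pos hx1
  set z : ℝ := x ^ (η' / 2) with hz
  -- the window is contained in the complement of the primes `≤ z`
  have hsplit := Finset.sum_filter_add_sum_filter_not (Nat.primesLE ⌊x⌋₊)
    (fun p : ℕ => Real.log p / Real.log x ≤ η' / 2) (fun p : ℕ => (p : ℝ)⁻¹)
  have hzsum : ∑ p ∈ (Nat.primesLE ⌊x⌋₊).filter (fun p : ℕ => Real.log p / Real.log x ≤ η' / 2),
      (p : ℝ)⁻¹ = Literature.NumberTheory.LFunctions.Mertens.primeRecipSum z := by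
    rw [Literature.NumberTheory.LFunctions.Mertens.primeRecipSum, hz,
      primesLE_filter_le_eq hx1 (by linarith : η' / 2 ≤ 1)]
  have hwin : ∑ p ∈ (Nat.primesLE ⌊x⌋₊).filter (fun p : ℕ => η' ≤ Real.log p / Real.log x),
      (p : ℝ)⁻¹ ≤ ∑ p ∈ (Nat.primesLE ⌊x⌋₊).filter
        (fun p : ℕ => ¬ Real.log p / Real.log x ≤ η' / 2), (p : ℝ)⁻¹ := by
    refine Finset.sum_le_sum_of_subset_of_nonneg ?_ (fun p _ _ => by positivity)
    intro p hp
    rw [Finset.mem_filter] at hp ⊢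
    exact ⟨hp.1, fun h => by linarith [hp.2]⟩
  have hM1 := Literature.NumberTheory.LFunctions.Mertens.abs_primeRecipSum_sub_le hx2
  have hM2 := Literature.NumberTheory.LFunctions.Mertens.abs_primeRecipSum_sub_le hz2
  have hPx : Literature.NumberTheory.LFunctions.Mertens.primeRecipSum x =
      ∑ p ∈ Nat.primesLE ⌊x⌋₊, (p : ℝ)⁻¹ := rfl
  have hlogz : Real.log (Real.log z) = Real.log (Real.log x) - Real.log (2 / η') := by
    rw [hz, Real.log_rpow hx0, Real.log_mul (by positivity) hL0.ne', Real.log_div (by norm_num) hη'.ne',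
      Real.log_div hη'.ne' (by norm_num)]
    ring
  have hlz : Real.log 2 ≤ Real.log z := Real.log_le_log (by norm_num) hz2
  have hlx : Real.log 2 ≤ Real.log x := Real.log_le_log (by norm_num) hx2
  have h8x : 8 / Real.log x ≤ 8 / Real.log 2 := div_le_div_of_nonneg_left (by norm_num) hlog2 hlx
  have h8z : 8 / Real.log z ≤ 8 / Real.log 2 := div_le_div_of_nonneg_left (by norm_num) hlog2 hlz
  rw [abs_le] at hM1 hM2
  have h16 : (16 : ℝ) / Real.log 2 = 8 / Real.log 2 + 8 / Real.log 2 := by ring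
  calc ∑ p ∈ (Nat.primesLE ⌊x⌋₊).filter (fun p : ℕ => η' ≤ Real.log p / Real.log x), (p : ℝ)⁻¹
      ≤ ∑ p ∈ (Nat.primesLE ⌊x⌋₊).filter (fun p : ℕ => ¬ Real.log p / Real.log x ≤ η' / 2),
          (p : ℝ)⁻¹ := hwin
    _ = Literature.NumberTheory.LFunctions.Mertens.primeRecipSum x -
          Literature.NumberTheory.LFunctions.Mertens.primeRecipSum z := by
        rw [hPx, ← hsplit, hzsum]; ring
    _ ≤ Real.log (2 / η') + 16 / Real.log 2 := by linarith [hM1.2, hM2.1]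

/-! ### Auxiliary analysis -/

/-- A measurable function on `ℝ^n`, bounded, and vanishing off a box is integrable. [folklore] -/
theorem integrable_of_bdd_of_support_box {n : ℕ} {f : (Fin n → ℝ) → ℝ} (hf : Measurable f)
    {B a b : ℝ} (hB : ∀ y, |f y| ≤ B)
    (hsupp : ∀ y, f y ≠ 0 → y ∈ Set.Icc (fun _ : Fin n => a) (fun _ => b)) : Integrable f := by
  have hIcc : IsCompact (Set.Icc (fun _ : Fin n => a) (fun _ : Fin n => b)) := isCompact_Icc
  have hon : IntegrableOn f (Set.Icc (fun _ : Fin n => a) (fun _ => b)) :=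
    Measure.integrableOn_of_bounded hIcc.measure_lt_top.ne hf.aestronglyMeasurable (M := B)
      (Filter.Eventually.of_forall fun y => by rw [Real.norm_eq_abs]; exact hB y)
  refine hon.integrable_of_forall_notMem_eq_zero fun y hy => ?_
  by_contra h
  exact hy (hsupp y h)

/-- A measurable function on `ℝ`, bounded, and vanishing off an interval is integrable. [folklore] -/
theorem integrable_of_bdd_of_support_Icc {f : ℝ → ℝ} (hf : Measurable f) {B a b : ℝ}
    (hB : ∀ y, |f y| ≤ B) (hsupp : ∀ y, f y ≠ 0 → y ∈ Set.Icc a b) : Integrable f := by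
  have hon : IntegrableOn f (Set.Icc a b) :=
    Measure.integrableOn_of_bounded (by simp) hf.aestronglyMeasurable (M := B)
      (Filter.Eventually.of_forall fun y => by rw [Real.norm_eq_abs]; exact hB y)
  refine hon.integrable_of_forall_notMem_eq_zero fun y hy => ?_
  by_contra h
  exact hy (hsupp y h)

/-- The weight `∏ x^{yᵢ}/yᵢ` is measurable in `y` (`x > 0`). [folklore] -/
theorem measurable_tupleWeight {s : ℕ} {x : ℝ} (hx : 0 < x) :
    Measurable fun y : Fin s → ℝ => tupleWeight x y := by
  unfold tupleWeight
  refine Finset.measurable_prod _ fun i _ => ?_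
  exact (((Real.continuous_const_rpow hx.ne').measurable).comp (measurable_pi_apply i)).div
    (measurable_pi_apply i)

/-- On the box `[η', 1]^s` (`0 < η'`, `1 ≤ x`): `0 ≤ ∏ x^{yᵢ}/yᵢ ≤ (x/η')^s`. [folklore] -/
theorem tupleWeight_bounds {s : ℕ} {x η' : ℝ} (hx : 1 ≤ x) (hη' : 0 < η') {y : Fin s → ℝ}
    (hy : ∀ i, η' ≤ y i ∧ y i ≤ 1) : 0 ≤ tupleWeight x y ∧ tupleWeight x y ≤ (x / η') ^ s := by
  have hx0 : 0 < x := by linarith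
  have hfac : ∀ i, 0 ≤ x ^ (y i) / y i ∧ x ^ (y i) / y i ≤ x / η' := by
    intro i
    have hy0 : 0 < y i := lt_of_lt_of_le hη' (hy i).1
    refine ⟨div_nonneg (Real.rpow_nonneg hx0.le _) hy0.le, ?_⟩
    calc x ^ (y i) / y i ≤ x / y i := by
          refine div_le_div_of_nonneg_right ?_ hy0.le
          calc x ^ (y i) ≤ x ^ (1 : ℝ) := Real.rpow_le_rpow_of_exponent_le hx (hy i).2
            _ = x := Real.rpow_one x
      _ ≤ x / η' := div_le_div_of_nonneg_left hx0.le hη' (hy i).1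
  unfold tupleWeight
  refine ⟨Finset.prod_nonneg fun i _ => (hfac i).1, ?_⟩
  calc ∏ i, x ^ (y i) / y i ≤ ∏ _i : Fin s, x / η' :=
        Finset.prod_le_prod (fun i _ => (hfac i).1) fun i _ => (hfac i).2
    _ = (x / η') ^ s := by rw [Finset.prod_const, Finset.card_univ, Fintype.card_fin]

/-- The sum of the coordinates of `snoc y' t`. [folklore] -/
theorem sum_snoc {s : ℕ} (y' : Fin s → ℝ) (t : ℝ) :
    ∑ i, (Fin.snoc y' t : Fin (s + 1) → ℝ) i = (∑ i, y' i) + t := by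
  rw [Fin.sum_univ_castSucc]
  simp only [Fin.snoc_castSucc, Fin.snoc_last]

/-! ### The one-dimensional step along the last coordinate -/

/-- **One-dimensional errors at a fixed initial segment.** Under the hypotheses of the main
estimate in dimension `s + 1`, for every `y' ∈ ℝ^s` the last-variable prime sum of the section
`t ↦ G(y', t)` is its integral up to
`C₁ (K+M) x^Y (log x)^{-A} ∏ᵢ 𝟙[y'ᵢ ≥ η'] x^{-y'ᵢ}` — the one-variable estimate applied on the
section `{t : (y', t) ∈ U}`, an interval on which the section is `K`-Lipschitz; if some
`y'ᵢ < η'` the section is empty and both sides vanish. [cite: FordMaynard2024PrimeSieves, Lemma 5.11 (proof)] -/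
theorem section_last_oneDim_bound {s A : ℕ} {x η' C₁ K M Y : ℝ} {U : Set (Fin (s + 1) → ℝ)}
    {G : (Fin (s + 1) → ℝ) → ℝ} (hx : 1 < x)
    (h1 : ∀ (I : Set ℝ) (φ : ℝ → ℝ) (K M b : ℝ), I.OrdConnected → I ⊆ Set.Icc η' 1 →
      (∀ y ∈ I, y ≤ b) → 0 ≤ K → 0 ≤ M → Measurable φ →
      (∀ y ∈ I, ∀ y' ∈ I, |φ y - φ y'| ≤ K * |y - y'|) → (∀ y, |φ y| ≤ M) →
      (∀ y, y ∉ I → φ y = 0) →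
      |(∑ q ∈ Nat.primesLE ⌊x⌋₊, φ (Real.log q / Real.log x)) - ∫ y, φ y * (x ^ y / y)| ≤
        C₁ * (K + M) * x ^ b / Real.log x ^ A)
    (hU : Convex ℝ U) (hUη : ∀ y ∈ U, ∀ i, η' ≤ y i) (hUY : ∀ y ∈ U, ∑ i, y i ≤ Y)
    (hY1 : Y ≤ 1) (hη' : 0 < η') (hK : 0 ≤ K) (hM : 0 ≤ M) (hGm : Measurable G)
    (hlip : ∀ y ∈ U, ∀ y' ∈ U, |G y - G y'| ≤ K * ‖y - y'‖) (hbd : ∀ y, |G y| ≤ M)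
    (hzero : ∀ y, y ∉ U → G y = 0) (y' : Fin s → ℝ) :
    |(∑ p ∈ Nat.primesLE ⌊x⌋₊, G (Fin.snoc y' (Real.log p / Real.log x))) -
        ∫ t, G (Fin.snoc y' t) * (x ^ t / t)| ≤
      C₁ * (K + M) * x ^ Y / Real.log x ^ A * ∏ i, (if η' ≤ y' i then x ^ (-(y' i)) else 0) := by
  have hx0 : 0 < x := by linarith
  by_cases hall : ∀ i, η' ≤ y' i
  · -- the section is an interval inside `[η', Y − ∑ y']`
    set I : Set ℝ := {t | (Fin.snoc y' t : Fin (s + 1) → ℝ) ∈ U} with hI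
    have hsum0 : 0 ≤ ∑ i, y' i := Finset.sum_nonneg fun i _ => hη'.le.trans (hall i)
    have hIb : ∀ t ∈ I, η' ≤ t ∧ t ≤ Y - ∑ i, y' i := by
      intro t ht
      have h1 := hUη _ ht (Fin.last s)
      simp only [Fin.snoc_last] at h1
      have h2 := hUY _ ht
      rw [sum_snoc] at h2
      exact ⟨h1, by linarith⟩
    have key := h1 I (fun t => G (Fin.snoc y' t)) K M (Y - ∑ i, y' i)
      (ordConnected_section_right hU y')
      (fun t ht => ⟨(hIb t ht).1, by linarith [(hIb t ht).2]⟩) (fun t ht => (hIb t ht).2) hK hM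
      (hGm.comp (measurable_snoc_right y'))
      (fun t ht t' ht' => by
        have := hlip _ ht _ ht'
        rwa [norm_snoc_sub_snoc_right] at this)
      (fun t => hbd _) (fun t ht => hzero _ ht)
    refine key.trans (le_of_eq ?_)
    have hprod : ∏ i, (if η' ≤ y' i then x ^ (-(y' i)) else 0) = x ^ (-(∑ i, y' i)) := by
      rw [← Finset.sum_neg_distrib, Real.rpow_sum_of_pos hx0]
      exact Finset.prod_congr rfl fun i _ => if_pos (hall i)
    rw [hprod, Real.rpow_sub hx0, Real.rpow_neg hx0.le, div_eq_mul_inv (x ^ Y)]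
    ring
  · -- some `y'ᵢ < η'`: the section is empty
    obtain ⟨i, hi⟩ : ∃ i, y' i < η' := by
      by_contra h
      exact hall fun i => not_lt.1 fun hi => h ⟨i, hi⟩
    have hempty : ∀ t : ℝ, (Fin.snoc y' t : Fin (s + 1) → ℝ) ∉ U := by
      intro t ht
      have := hUη _ ht (Fin.castSucc i)
      simp only [Fin.snoc_castSucc] at this
      linarith
    have hG0 : ∀ t : ℝ, G (Fin.snoc y' t) = 0 := fun t => hzero _ (hempty t)
    simp only [hG0, Finset.sum_const_zero, zero_mul, integral_zero, sub_zero, abs_zero]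
    rw [Finset.prod_eq_zero (Finset.mem_univ i) (if_neg (not_le.2 hi)), mul_zero]

/-! ### The main estimate -/

/-- **Prime tuple sums against Lipschitz test functions on convex sets.** For `0 < η' ≤ 1`,
`A, s ∈ ℕ` there are `C ≥ 0`, `X ≥ 2` such that for `x ≥ X`: if `U ⊆ ℝ^s` is convex and
measurable with `yᵢ ≥ η'` and `∑ yᵢ ≤ Y ≤ 1` on `U`, and `G` is measurable, `K`-Lipschitz on `U`
(sup norm), bounded by `M` and zero off `U`, then
`|∑_{q ∈ primes(≤ x)^s} G((log qᵢ/log x)ᵢ) − ∫ G(y) ∏ x^{yᵢ} dyᵢ/yᵢ| ≤ C (K + M) x^Y/(log x)^A`.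
Ford–Maynard's Lemma 5.11 is the case of a convex polytope and the normalised coordinates; the
log-power saving replaces their `exp(−(log x)^{1/5})`. [cite: FordMaynard2024PrimeSieves, Lemma 5.11] -/
theorem exists_primeTupleSum_approx (η' : ℝ) (hη' : 0 < η') (hη'1 : η' ≤ 1) (A s : ℕ) :
    ∃ C : ℝ, 0 ≤ C ∧ ∃ X : ℝ, 2 ≤ X ∧ ∀ x : ℝ, X ≤ x →
      ∀ (U : Set (Fin s → ℝ)) (G : (Fin s → ℝ) → ℝ) (K M Y : ℝ), Convex ℝ U → MeasurableSet U →
        (∀ y ∈ U, ∀ i, η' ≤ y i) → (∀ y ∈ U, ∑ i, y i ≤ Y) → Y ≤ 1 → 0 ≤ K → 0 ≤ M →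
        Measurable G → (∀ y ∈ U, ∀ y' ∈ U, |G y - G y'| ≤ K * ‖y - y'‖) → (∀ y, |G y| ≤ M) →
        (∀ y, y ∉ U → G y = 0) →
        |primeTupleSum s x G - primeTupleIntegral s x G| ≤ C * (K + M) * x ^ Y / Real.log x ^ A := by
  induction s with
  | zero =>
    refine ⟨0, le_rfl, 2, le_rfl, ?_⟩
    intro x hx U G K M Y _ _ _ _ _ _ _ _ _ _ _
    have hsum : primeTupleSum 0 x G = G default := by
      unfold primeTupleSum
      rw [Finset.sum_congr rfl (fun q _ => congrArg G (Subsingleton.elim (logVec x q) default)),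
        Finset.sum_const, Fintype.card_piFinset]
      simp
    have hint : primeTupleIntegral 0 x G = G default := by
      unfold primeTupleIntegral tupleWeight
      rw [Measure.volume_pi_eq_dirac (default : Fin 0 → ℝ), integral_dirac]
      simp
    rw [hsum, hint, sub_self, abs_zero]
    simp
  | succ s ih =>
    obtain ⟨C₁, hC₁0, X₁, hX₁2, h1⟩ := exists_primeSum_approx η' hη' hη'1 A
    obtain ⟨Cs, hCs0, Xs, hXs2, hs⟩ := ih
    obtain ⟨W, hW0, XW, hXW2, hW⟩ := exists_sum_primesLE_inv_window_le η' hη' hη'1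
    have hlogη : 0 ≤ Real.log (1 / η') := Real.log_nonneg ((one_le_div hη').2 (by linarith))
    refine ⟨C₁ * W ^ s + Cs * Real.log (1 / η'), by positivity,
      max (max X₁ Xs) (max XW 3), le_trans (by norm_num) (le_max_right _ _ |>.trans' (le_max_right _ _)), ?_⟩
    intro x hx U G K M Y hU hUm hUη hUY hY1 hK hM hGm hlip hbd hzero
    have hxX₁ : X₁ ≤ x := le_trans (le_trans (le_max_left _ _) (le_max_left _ _)) hx
    have hxXs : Xs ≤ x := le_trans (le_trans (le_max_right _ _) (le_max_left _ _)) hx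
    have hxXW : XW ≤ x := le_trans (le_trans (le_max_left _ _) (le_max_right _ _)) hx
    have hx3 : 3 ≤ x := le_trans (le_trans (le_max_right _ _) (le_max_right _ _)) hx
    have hx1 : 1 < x := by linarith
    have hx0 : 0 < x := by linarith
    have hL0 : 0 < Real.log x := Real.log_pos hx1
    set L : ℝ := Real.log x with hL
    have hLA : 0 < L ^ A := pow_pos hL0 A
    set P : Finset ℕ := Nat.primesLE ⌊x⌋₊ with hP
    -- coordinates of points of `U` lie in `[η', 1]`
    have hUbox : ∀ y ∈ U, ∀ i, η' ≤ y i ∧ y i ≤ 1 := by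
      intro y hy i
      refine ⟨hUη y hy i, ?_⟩
      have hsum := hUY y hy
      have : y i + ∑ j ∈ Finset.univ.erase i, y j = ∑ j, y j := Finset.add_sum_erase _ _ (Finset.mem_univ i)
      have hrest : 0 ≤ ∑ j ∈ Finset.univ.erase i, y j :=
        Finset.sum_nonneg fun j _ => hη'.le.trans (hUη y hy j)
      linarith
    -- sections along the last coordinate: `t ∈ [η', 1]` whenever `snoc y' t ∈ U`
    have hsecT : ∀ (y' : Fin s → ℝ) (t : ℝ), (Fin.snoc y' t : Fin (s + 1) → ℝ) ∈ U →
        (η' ≤ t ∧ t ≤ 1) ∧ (∀ i, η' ≤ y' i ∧ y' i ≤ 1) ∧ (∑ i, y' i) + t ≤ Y := by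
      intro y' t ht
      refine ⟨?_, fun i => ?_, ?_⟩
      · have := hUbox _ ht (Fin.last s); simpa only [Fin.snoc_last] using this
      · have := hUbox _ ht (Fin.castSucc i); simpa only [Fin.snoc_castSucc] using this
      · have := hUY _ ht; rwa [sum_snoc] at this
    ------------------------------------------------------------------
    -- Step 1: the sum side, and the one-dimensional errors
    ------------------------------------------------------------------
    have hPS : primeTupleSum (s + 1) x G = ∑ q' ∈ Fintype.piFinset (fun _ : Fin s => P),
        ∑ p ∈ P, G (Fin.snoc (logVec x q') (Real.log p / L)) := primeTupleSum_succ s x G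
    -- the integral of each one-dimensional section
    set J : (Fin s → ℝ) → ℝ := fun y' => ∫ t, G (Fin.snoc y' t) * (x ^ t / t) with hJ
    have hD1 : ∀ y' : Fin s → ℝ,
        |(∑ p ∈ P, G (Fin.snoc y' (Real.log p / L))) - J y'| ≤
          C₁ * (K + M) * x ^ Y / L ^ A * ∏ i, (if η' ≤ y' i then x ^ (-(y' i)) else 0) :=
      fun y' => section_last_oneDim_bound hx1 (h1 x hxX₁) hU hUη hUY hY1 hη' hK hM hGm hlip hbd
        hzero y'
    -- summing the one-dimensional errors over `q' ∈ P^s`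
    have hwp : ∀ p ∈ P, (if η' ≤ Real.log p / L then x ^ (-(Real.log p / L)) else 0) =
        if η' ≤ Real.log p / L then (p : ℝ)⁻¹ else 0 := by
      intro p hp
      rw [hP, Nat.mem_primesLE] at hp
      split_ifs
      · -- `x^{log p/log x} = p` (as in `Literature.NumberTheory.Sieve.Chen.rpow_log_div_log`)
        rw [Real.rpow_neg hx0.le, Real.rpow_def_of_pos hx0, mul_div_cancel₀ _ hL0.ne',
          Real.exp_log (by exact_mod_cast hp.2.pos)]
      · rfl
    have hWsum : ∑ p ∈ P, (if η' ≤ Real.log p / L then x ^ (-(Real.log p / L)) else 0) ≤ W := by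
      rw [Finset.sum_congr rfl hwp, ← Finset.sum_filter]
      exact hW x hxXW
    have hE1 : ∑ q' ∈ Fintype.piFinset (fun _ : Fin s => P),
        |(∑ p ∈ P, G (Fin.snoc (logVec x q') (Real.log p / L))) - J (logVec x q')| ≤
          C₁ * (K + M) * x ^ Y / L ^ A * W ^ s := by
      calc ∑ q' ∈ Fintype.piFinset (fun _ : Fin s => P),
            |(∑ p ∈ P, G (Fin.snoc (logVec x q') (Real.log p / L))) - J (logVec x q')|
          ≤ ∑ q' ∈ Fintype.piFinset (fun _ : Fin s => P), C₁ * (K + M) * x ^ Y / L ^ A *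
              ∏ i, (if η' ≤ logVec x q' i then x ^ (-(logVec x q' i)) else 0) :=
            Finset.sum_le_sum fun q' _ => hD1 _
        _ = C₁ * (K + M) * x ^ Y / L ^ A * ∑ q' ∈ Fintype.piFinset (fun _ : Fin s => P),
              ∏ i, (if η' ≤ Real.log (q' i) / L then x ^ (-(Real.log (q' i) / L)) else 0) := by
            rw [Finset.mul_sum]; rfl
        _ = C₁ * (K + M) * x ^ Y / L ^ A *
              (∑ p ∈ P, (if η' ≤ Real.log p / L then x ^ (-(Real.log p / L)) else 0)) ^ s := by
            rw [Finset.sum_pow']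
        _ ≤ C₁ * (K + M) * x ^ Y / L ^ A * W ^ s := by
            refine mul_le_mul_of_nonneg_left ?_ (by positivity)
            exact pow_le_pow_left₀ (Finset.sum_nonneg fun p _ => by
              split_ifs <;> first | exact Real.rpow_nonneg hx0.le _ | exact le_rfl) hWsum s
    ------------------------------------------------------------------
    -- Step 2: integrability of the one-dimensional sections and of the full integrand
    ------------------------------------------------------------------
    have hsec_int : ∀ y' : Fin s → ℝ, Integrable fun t => G (Fin.snoc y' t) * (x ^ t / t) := by
      intro y'
      refine integrable_of_bdd_of_support_Icc
        ((hGm.comp (measurable_snoc_right y')).mul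
          (((Real.continuous_const_rpow hx0.ne').measurable).div measurable_id))
        (B := M * (x / η')) (a := η') (b := 1) (fun t => ?_) (fun t ht => ?_)
      · by_cases hmem : (Fin.snoc y' t : Fin (s + 1) → ℝ) ∈ U
        · obtain ⟨⟨ht1, ht2⟩, -, -⟩ := hsecT y' t hmem
          have ht0 : 0 < t := lt_of_lt_of_le hη' ht1
          rw [abs_mul, abs_of_nonneg (div_nonneg (Real.rpow_nonneg hx0.le _) ht0.le)]
          refine mul_le_mul (hbd _) ?_ (div_nonneg (Real.rpow_nonneg hx0.le _) ht0.le) hM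
          calc x ^ t / t ≤ x / t := by
                refine div_le_div_of_nonneg_right ?_ ht0.le
                calc x ^ t ≤ x ^ (1 : ℝ) := Real.rpow_le_rpow_of_exponent_le hx1.le ht2
                  _ = x := Real.rpow_one x
            _ ≤ x / η' := div_le_div_of_nonneg_left hx0.le hη' ht1
        · rw [hzero _ hmem, zero_mul, abs_zero]; positivity
      · have hmem : (Fin.snoc y' t : Fin (s + 1) → ℝ) ∈ U := by
          by_contra h; exact ht (by rw [hzero _ h, zero_mul])
        exact (hsecT y' t hmem).1
    -- the full integrand `H = G · weight`
    set H : (Fin (s + 1) → ℝ) → ℝ := fun y => G y * tupleWeight x y with hH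
    have hHint : Integrable H := by
      refine integrable_of_bdd_of_support_box (hGm.mul (measurable_tupleWeight hx0))
        (B := M * (x / η') ^ (s + 1)) (a := η') (b := 1) (fun y => ?_) (fun y hy => ?_)
      · by_cases hmem : y ∈ U
        · have hw := tupleWeight_bounds hx1.le hη' (hUbox y hmem)
          show |G y * tupleWeight x y| ≤ _
          rw [abs_mul, abs_of_nonneg hw.1]
          exact mul_le_mul (hbd _) hw.2 hw.1 hM
        · show |G y * tupleWeight x y| ≤ _
          rw [hzero _ hmem, zero_mul, abs_zero]; positivity
      · have hmem : y ∈ U := by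
          by_contra h; exact hy (by show G y * tupleWeight x y = 0; rw [hzero _ h, zero_mul])
        exact ⟨fun i => (hUbox y hmem i).1, fun i => (hUbox y hmem i).2⟩
    obtain ⟨hFub, hmarg⟩ := integral_eq_integral_snoc hHint
    -- the inner integrals are the integrals of the sections, times the weight `x^t/t`
    have hinner : ∀ t : ℝ, ∫ y' : Fin s → ℝ, H (Fin.snoc y' t) =
        primeTupleIntegral s x (fun y' => G (Fin.snoc y' t)) * (x ^ t / t) := by
      intro t
      unfold primeTupleIntegral
      rw [← integral_mul_const]
      refine integral_congr_ae (Filter.Eventually.of_forall fun y' => ?_)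
      show G (Fin.snoc y' t) * tupleWeight x (Fin.snoc y' t) = _
      rw [tupleWeight_snoc]; ring
    have hIN : primeTupleIntegral (s + 1) x G =
        ∫ t, primeTupleIntegral s x (fun y' => G (Fin.snoc y' t)) * (x ^ t / t) := by
      show (∫ y, H y) = _
      rw [hFub]
      exact integral_congr_ae (Filter.Eventually.of_forall hinner)
    have hmarg' : Integrable fun t => primeTupleIntegral s x (fun y' => G (Fin.snoc y' t)) *
        (x ^ t / t) := by
      refine (integrable_congr (Filter.Eventually.of_forall fun t => ?_)).1 hmarg
      exact hinner t
    ------------------------------------------------------------------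
    -- Step 3: the sections `G(·, t)` and the induction hypothesis
    ------------------------------------------------------------------
    have hIH : ∀ t : ℝ,
        |(primeTupleSum s x (fun y' => G (Fin.snoc y' t)) -
            primeTupleIntegral s x (fun y' => G (Fin.snoc y' t))) * (x ^ t / t)| ≤
          Set.indicator (Set.Icc η' 1) (fun t => Cs * (K + M) * x ^ Y / L ^ A * t⁻¹) t := by
      intro t
      by_cases ht : t ∈ Set.Icc η' 1
      · rw [Set.indicator_of_mem ht]
        have ht0 : 0 < t := lt_of_lt_of_le hη' ht.1
        -- the induction hypothesis for the section at `t`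
        have key := hs x hxXs {y' : Fin s → ℝ | (Fin.snoc y' t : Fin (s + 1) → ℝ) ∈ U}
          (fun y' => G (Fin.snoc y' t)) K M (Y - t) (convex_section_left hU t)
          (measurable_snoc_left t hUm)
          (fun y' hy' i => ((hsecT y' t hy').2.1 i).1)
          (fun y' hy' => by linarith [(hsecT y' t hy').2.2]) (by linarith [ht.1])
          hK hM (hGm.comp (measurable_snoc_left t))
          (fun y hy z hz => by
            have := hlip _ hy _ hz
            rwa [norm_snoc_sub_snoc_left] at this)
          (fun y' => hbd _) (fun y' hy' => hzero _ hy')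
        rw [abs_mul, abs_of_nonneg (div_nonneg (Real.rpow_nonneg hx0.le _) ht0.le)]
        calc |primeTupleSum s x (fun y' => G (Fin.snoc y' t)) -
              primeTupleIntegral s x (fun y' => G (Fin.snoc y' t))| * (x ^ t / t)
            ≤ Cs * (K + M) * x ^ (Y - t) / L ^ A * (x ^ t / t) :=
              mul_le_mul_of_nonneg_right key (div_nonneg (Real.rpow_nonneg hx0.le _) ht0.le)
          _ = Cs * (K + M) * x ^ Y / L ^ A * t⁻¹ := by
              rw [Real.rpow_sub hx0]
              field_simp
      · rw [Set.indicator_of_notMem ht]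
        -- empty section
        have hempty : ∀ y' : Fin s → ℝ, (Fin.snoc y' t : Fin (s + 1) → ℝ) ∉ U :=
          fun y' hy' => ht (hsecT y' t hy').1
        have hG0 : ∀ y' : Fin s → ℝ, G (Fin.snoc y' t) = 0 := fun y' => hzero _ (hempty y')
        have h0 : primeTupleSum s x (fun y' => G (Fin.snoc y' t)) = 0 := by
          unfold primeTupleSum; exact Finset.sum_eq_zero fun q _ => hG0 _
        have h0' : primeTupleIntegral s x (fun y' => G (Fin.snoc y' t)) = 0 := by
          unfold primeTupleIntegral; simp [hG0]
        rw [h0, h0', sub_self, zero_mul, abs_zero]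
    have hbnd_int : Integrable
        (Set.indicator (Set.Icc η' 1) (fun t : ℝ => Cs * (K + M) * x ^ Y / L ^ A * t⁻¹)) := by
      rw [integrable_indicator_iff measurableSet_Icc]
      refine (ContinuousOn.integrableOn_Icc ?_)
      exact continuousOn_const.mul (continuousOn_inv₀.mono fun t ht => (lt_of_lt_of_le hη' ht.1).ne')
    have hbnd_val : ∫ t, Set.indicator (Set.Icc η' 1)
        (fun t : ℝ => Cs * (K + M) * x ^ Y / L ^ A * t⁻¹) t =
        Cs * (K + M) * x ^ Y / L ^ A * Real.log (1 / η') := by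
      rw [integral_indicator measurableSet_Icc, integral_Icc_eq_integral_Ioc,
        ← intervalIntegral.integral_of_le hη'1, intervalIntegral.integral_const_mul,
        integral_inv_of_pos hη' one_pos]
    have hE2 : |∫ t, (primeTupleSum s x (fun y' => G (Fin.snoc y' t)) -
        primeTupleIntegral s x (fun y' => G (Fin.snoc y' t))) * (x ^ t / t)| ≤
        Cs * (K + M) * x ^ Y / L ^ A * Real.log (1 / η') := by
      rw [← hbnd_val, ← Real.norm_eq_abs]
      refine norm_integral_le_of_norm_le hbnd_int (Filter.Eventually.of_forall fun t => ?_)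
      rw [Real.norm_eq_abs]; exact hIH t
    ------------------------------------------------------------------
    -- Step 4: assembling
    ------------------------------------------------------------------
    -- the sum of the one-dimensional integrals is the integral of the section sums
    have hJsum : ∑ q' ∈ Fintype.piFinset (fun _ : Fin s => P), J (logVec x q') =
        ∫ t, primeTupleSum s x (fun y' => G (Fin.snoc y' t)) * (x ^ t / t) := by
      rw [hJ, ← integral_finsetSum _ (fun q' _ => hsec_int (logVec x q'))]
      refine integral_congr_ae (Filter.Eventually.of_forall fun t => ?_)
      show ∑ q' ∈ Fintype.piFinset (fun _ : Fin s => P), G (Fin.snoc (logVec x q') t) * (x ^ t / t) =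
        primeTupleSum s x (fun y' => G (Fin.snoc y' t)) * (x ^ t / t)
      rw [primeTupleSum_section, Finset.sum_mul]
    have hPSint : Integrable fun t => primeTupleSum s x (fun y' => G (Fin.snoc y' t)) *
        (x ^ t / t) := by
      have : (fun t => primeTupleSum s x (fun y' => G (Fin.snoc y' t)) * (x ^ t / t)) =
          fun t => ∑ q' ∈ Fintype.piFinset (fun _ : Fin s => P),
            G (Fin.snoc (logVec x q') t) * (x ^ t / t) := by
        funext t; rw [primeTupleSum_section, Finset.sum_mul]
      rw [this]
      exact integrable_finsetSum _ fun q' _ => hsec_int (logVec x q')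
    -- the decomposition
    have hdecomp : primeTupleSum (s + 1) x G - primeTupleIntegral (s + 1) x G =
        (∑ q' ∈ Fintype.piFinset (fun _ : Fin s => P),
          ((∑ p ∈ P, G (Fin.snoc (logVec x q') (Real.log p / L))) - J (logVec x q'))) +
        ∫ t, (primeTupleSum s x (fun y' => G (Fin.snoc y' t)) -
          primeTupleIntegral s x (fun y' => G (Fin.snoc y' t))) * (x ^ t / t) := by
      rw [Finset.sum_sub_distrib, hJsum, hPS, hIN]
      have : ∫ t, (primeTupleSum s x (fun y' => G (Fin.snoc y' t)) -
          primeTupleIntegral s x (fun y' => G (Fin.snoc y' t))) * (x ^ t / t) =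
          (∫ t, primeTupleSum s x (fun y' => G (Fin.snoc y' t)) * (x ^ t / t)) -
            ∫ t, primeTupleIntegral s x (fun y' => G (Fin.snoc y' t)) * (x ^ t / t) := by
        rw [← integral_sub hPSint hmarg']
        refine integral_congr_ae (Filter.Eventually.of_forall fun t => ?_)
        show _ = _ - _
        ring
      rw [this]
      ring
    rw [hdecomp]
    refine (abs_add_le _ _).trans ?_
    refine (add_le_add ((Finset.abs_sum_le_sum_abs _ _).trans hE1) hE2).trans (le_of_eq ?_)
    ring

end Literature.NumberTheory.Sieve.FordMaynard
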